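import Mathlib.Analysis.InnerProductSpace.Laplacian
import Mathlib.Analysis.InnerProductSpace.Calculus
import Mathlib.Analysis.InnerProductSpace.Trace
import Mathlib.Analysis.InnerProductSpace.PiL2
import Mathlib.Analysis.Calculus.Gradient.Basic
import Mathlib.Analysis.Calculus.LineDeriv.Basic
import Mathlib.Analysis.Calculus.FDeriv.Add
import Mathlib.LinearAlgebra.Trace
import Literature.Analysis.FluidPDE.VectorCalculus
import HarnessLib

/-!
# The deviatoric (trace-free) Hessian of a scalar field

Analysis/FluidPDE definition file (requested by route NavierStokesRegularity/IsobarTomography,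
card `isobar-curvature-tomography-pressure-hessian`, object `H`).

Let `E` be a finite-dimensional real inner product space of dimension `d` and `q : E → ℝ`. The
Hessian of `q` at `x`, viewed as the endomorphism `∇²q(x) = D(∇q)(x) : E →L[ℝ] E` (the Fréchet
derivative of the gradient field; `⟪v, D(∇q)(x) w⟫ = D²q(x)[w, v]`,
`inner_fderiv_gradient_eq_iteratedFDeriv`), splits into its isotropic part `(Δq(x)/d) · I`
(`tr ∇²q = Δq`, `trace_fderiv_gradient`) and its **deviatoric (trace-free) part**

  `H(q)(x) = D(∇q)(x) − (Δq(x)/d) · I`        (`deviatoricHessian`),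

the standard deviator of a second-order tensor (continuum mechanics) applied to the Hessian.
The two parts are Frobenius-orthogonal: `|∇²q|² = |H|² + (Δq)²/d`
(`frobeniusNormSq_fderiv_gradient`, with the tree's `frobeniusNormSq`, `FluidPDE/VectorCalculus`).
For the Navier–Stokes pressure, `Δp = ½|ω|² − |S|² = −tr (∇u)²` (Majda–Bertozzi (1.84)) makes the
isotropic part a LOCAL function of the velocity gradient, while `H` is the NON-LOCAL
(Calderón–Zygmund, `H = (∇∇ − (Δ/3) I) Δ⁻¹ Δp`) part of the pressure Hessian `P = (p_{x_i x_k})`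
entering the velocity-gradient equation `DV/Dt + V² = −P + νΔV` (Majda–Bertozzi (1.29)); this is
the decomposition of Ohkitani–Kishiba (Phys. Fluids 7 (1995) 411) used throughout the
restricted-Euler / pressure-Hessian literature.

## Main statements (all pointwise, no smoothness hypotheses unless stated)

* `Literature.Analysis.FluidPDE.deviatoricHessian`: the definition, `E →L[ℝ] E`-valued.
* `Literature.Analysis.FluidPDE.trace_fderiv_gradient`: `tr D(∇q)(x) = Δq(x)`.
* `Literature.Analysis.FluidPDE.trace_deviatoricHessian`: `tr H = 0`.
* `Literature.Analysis.FluidPDE.frobeniusNormSq_fderiv_gradient`: `|D(∇q)(x)|² = |H|² + (Δq(x))²/d`.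
* `Literature.Analysis.FluidPDE.inner_deviatoricHessian_apply`:
  `⟪v, H w⟫ = D²q(x)[w, v] − (Δq(x)/d) ⟪v, w⟫`; `isSymmetric_deviatoricHessian`: `H` is
  self-adjoint when `q` is `C²` at `x`.
* `Literature.Analysis.FluidPDE.deviatoricHessian_radial_quadratic`: `H ≡ 0` for
  `q(y) = a‖y − x₀‖² + c`.
* `Literature.Analysis.FluidPDE.inner_deviatoricHessian_self_of_forall_add_smul`: if `q` is
  invariant under translations along `e`, then `⟪e, H e⟫ = −(Δq/d)‖e‖²`; on `ℝ³` with `e = e₃`: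
  `⟪e₃, H e₃⟫ = −Δq/3` (`inner_deviatoricHessian_e₃_of_zInvariant`).

## Design notes

* Everything except smoothness-free algebra is routed through `fderiv ℝ (fderiv ℝ q) x`, of which
  both `D(∇q)(x)` (`∇q = (toDual)⁻¹ ∘ Dq`, an isometry, so `LinearIsometryEquiv.comp_fderiv` needs
  no differentiability) and `Δq(x)` (Mathlib's `laplacian_eq_iteratedFDeriv_orthonormalBasis`) are
  functions; hence `tr H = 0` and the Frobenius splitting hold for every `q` and `x`, with the
  junk value `fderiv = 0` where `q` is not twice differentiable.
* `d = 0` (trivial `E`): the quotient `Δq/d` is Lean's `x/0 = 0` and every endomorphism is `0`;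
  all statements remain true (documented junk value).
* Imports are kept to `FluidPDE/VectorCalculus` + Mathlib so that the import cone of route files
  using `H` does not grow; in particular `tr D(∇q) = Δq` is proved here for all `q` rather than
  imported as the `C²` statement `divergence_gradient` of `FluidPDE/PressurePoisson`.

## References

* A. J. Majda, A. L. Bertozzi, *Vorticity and Incompressible Flow*, CUP 2002
  (`MajdaBertozziCUP2002`), §1.4, proof of Prop. 1.5, eq. (1.29) (the pressure Hessian `P`), and
  §1.8, eq. (1.84).
* K. Ohkitani, S. Kishiba, *Nonlocal nature of vortex stretching in an inviscid fluid*,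
  Phys. Fluids 7 (1995) 411–421, doi:10.1063/1.868638 (`OhkitaniKishiba1995`; the split of the
  pressure Hessian into its isotropic, local part and its trace-free, non-local part).
-/

noncomputable section

open InnerProductSpace Module
open scoped RealInnerProductSpace Laplacian

namespace Literature.Analysis.FluidPDE

variable {E : Type*} [NormedAddCommGroup E] [InnerProductSpace ℝ E] [FiniteDimensional ℝ E]

/-! ### The Hessian as an endomorphism: `⟪v, D(∇q) w⟫ = D²q[w, v]` and `tr D(∇q) = Δq` -/

omit [FiniteDimensional ℝ E] in
/-- The derivative of the gradient field is the Hessian: `⟪v, D(∇q)(x) w⟫ = D²q(x)[w, v]`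
(as `iteratedFDeriv ℝ 2 q x ![w, v]`), for every `q` and `x` (no differentiability needed:
`∇q = (toDual ℝ E)⁻¹ ∘ Dq` with an isometry). [folklore] -/
theorem inner_fderiv_gradient_eq_iteratedFDeriv [CompleteSpace E] (q : E → ℝ) (x v w : E) :
    ⟪v, fderiv ℝ (gradient q) x w⟫ = iteratedFDeriv ℝ 2 q x ![w, v] := by
  have h : gradient q = (InnerProductSpace.toDual ℝ E).symm ∘ fderiv ℝ q := rfl
  have h2 : fderiv ℝ (gradient q) x w =
      (InnerProductSpace.toDual ℝ E).symm (fderiv ℝ (fderiv ℝ q) x w) := by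
    rw [h, LinearIsometryEquiv.comp_fderiv]
    rfl
  rw [h2, real_inner_comm, InnerProductSpace.toDual_symm_apply, iteratedFDeriv_two_apply]
  simp only [Matrix.cons_val_zero, Matrix.cons_val_one]

/-- **`tr ∇²q = Δq`:** the trace of the Hessian endomorphism `D(∇q)(x)` is the Laplacian, for
every `q : E → ℝ` and `x` (both sides are read off `D²q(x)`; cf. the `C²` statement
`divergence_gradient`, `div ∇q = Δq`, in `FluidPDE/PressurePoisson`). [folklore] -/
theorem trace_fderiv_gradient (q : E → ℝ) (x : E) :
    LinearMap.trace ℝ E (fderiv ℝ (gradient q) x : E →ₗ[ℝ] E) = (Δ q) x := by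
  haveI : CompleteSpace E := FiniteDimensional.complete ℝ E
  set b := stdOrthonormalBasis ℝ E
  rw [LinearMap.trace_eq_sum_inner _ b, laplacian_eq_iteratedFDeriv_orthonormalBasis q b]
  exact Finset.sum_congr rfl fun i _ => by
    simpa using inner_fderiv_gradient_eq_iteratedFDeriv q x (b i) (b i)

/-! ### The deviatoric Hessian -/

/-- The **deviatoric (trace-free) Hessian** of a scalar field `q : E → ℝ` at `x`,
`H(q)(x) = D(∇q)(x) − (Δq(x)/d) · I : E →L[ℝ] E`, `d = dim E`: the Hessian endomorphism
`∇²q(x) = D(∇q)(x)` minus its isotropic part, i.e. the deviator of the Hessian tensor. Thus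
`∇²q = H + (Δq/d) I` (`fderiv_gradient_eq_deviatoricHessian_add`), `tr H = 0`
(`trace_deviatoricHessian`) and `|∇²q|² = |H|² + (Δq)²/d` (`frobeniusNormSq_fderiv_gradient`).
For the Navier–Stokes pressure (`Δp = ½|ω|² − |S|²`, local in `∇u`) `H` is the non-local part of
the pressure Hessian `P` of the velocity-gradient equation `DV/Dt + V² = −P + νΔV`
(Majda–Bertozzi 2002, (1.29), (1.84); Ohkitani–Kishiba 1995). Junk values: `fderiv`, `Δ` are `0`
where `q` is not (twice) differentiable, and for `d = 0` the coefficient `Δq/d` is `0`.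
[folklore] -/
def deviatoricHessian (q : E → ℝ) (x : E) : E →L[ℝ] E :=
  fderiv ℝ (gradient q) x - ((Δ q) x / (finrank ℝ E : ℝ)) • ContinuousLinearMap.id ℝ E

/-- Unfolding `deviatoricHessian`. [folklore] -/
theorem deviatoricHessian_def (q : E → ℝ) (x : E) :
    deviatoricHessian q x =
      fderiv ℝ (gradient q) x - ((Δ q) x / (finrank ℝ E : ℝ)) • ContinuousLinearMap.id ℝ E :=
  rfl

/-- `H v = D(∇q)(x) v − (Δq(x)/d) v`. [folklore] -/
theorem deviatoricHessian_apply (q : E → ℝ) (x v : E) :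
    deviatoricHessian q x v = fderiv ℝ (gradient q) x v - ((Δ q) x / (finrank ℝ E : ℝ)) • v :=
  rfl

/-- The isotropic–deviatoric splitting of the Hessian: `D(∇q)(x) = H + (Δq(x)/d) · I`. [folklore] -/
theorem fderiv_gradient_eq_deviatoricHessian_add (q : E → ℝ) (x : E) :
    fderiv ℝ (gradient q) x =
      deviatoricHessian q x + ((Δ q) x / (finrank ℝ E : ℝ)) • ContinuousLinearMap.id ℝ E :=
  (sub_add_cancel _ _).symm

/-- **The deviatoric Hessian is trace free**, `tr H(q)(x) = 0`, for every `q` and `x`. [folklore] -/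
theorem trace_deviatoricHessian (q : E → ℝ) (x : E) :
    LinearMap.trace ℝ E (deviatoricHessian q x : E →ₗ[ℝ] E) = 0 := by
  rcases subsingleton_or_nontrivial E with hE | hE
  · have h0 : (deviatoricHessian q x : E →ₗ[ℝ] E) = 0 :=
      LinearMap.ext fun v => Subsingleton.elim _ _
    rw [h0, map_zero]
  · have hd : (finrank ℝ E : ℝ) ≠ 0 := Nat.cast_ne_zero.2 finrank_pos.ne'
    rw [deviatoricHessian, ContinuousLinearMap.toLinearMap_sub, map_sub,
      ContinuousLinearMap.toLinearMap_smul, map_smul, ContinuousLinearMap.coe_id,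
      LinearMap.trace_id, trace_fderiv_gradient, smul_eq_mul, div_mul_cancel₀ _ hd, sub_self]

/-- `⟪v, H w⟫ = D²q(x)[w, v] − (Δq(x)/d) ⟪v, w⟫`. [folklore] -/
theorem inner_deviatoricHessian_apply (q : E → ℝ) (x v w : E) :
    ⟪v, deviatoricHessian q x w⟫ =
      iteratedFDeriv ℝ 2 q x ![w, v] - (Δ q) x / (finrank ℝ E : ℝ) * ⟪v, w⟫ := by
  haveI : CompleteSpace E := FiniteDimensional.complete ℝ E
  rw [deviatoricHessian_apply, inner_sub_right, inner_fderiv_gradient_eq_iteratedFDeriv,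
    real_inner_smul_right]

/-- The axial second derivative split off its isotropic share:
`D²q(x)[v, v] = ⟪v, H v⟫ + (Δq(x)/d) ‖v‖²` (the form in which the axial pressure curvature
`∇²p(ξ, ξ)` is compared with `Δp`). [folklore] -/
theorem iteratedFDeriv_two_self_eq_inner_deviatoricHessian_add (q : E → ℝ) (x v : E) :
    iteratedFDeriv ℝ 2 q x ![v, v] =
      ⟪v, deviatoricHessian q x v⟫ + (Δ q) x / (finrank ℝ E : ℝ) * ‖v‖ ^ 2 := by
  rw [inner_deviatoricHessian_apply, real_inner_self_eq_norm_sq, sub_add_cancel]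

/-- **Symmetry.** For `q` twice continuously differentiable at `x` the deviatoric Hessian is
self-adjoint: `⟪v, H w⟫ = ⟪w, H v⟫` (Schwarz's theorem, Mathlib's `ContDiffAt.isSymmSndFDerivAt`).
[folklore] -/
theorem inner_deviatoricHessian_comm {q : E → ℝ} {x : E} (hq : ContDiffAt ℝ 2 q x) (v w : E) :
    ⟪v, deviatoricHessian q x w⟫ = ⟪w, deviatoricHessian q x v⟫ := by
  have h2 : minSmoothness ℝ 2 ≤ (2 : WithTop ℕ∞) := by
    rw [minSmoothness_of_isRCLikeNormedField]
  have hs : IsSymmSndFDerivAt ℝ q x := hq.isSymmSndFDerivAt h2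
  rw [inner_deviatoricHessian_apply, inner_deviatoricHessian_apply, real_inner_comm v w,
    iteratedFDeriv_two_apply, iteratedFDeriv_two_apply]
  simp only [Matrix.cons_val_zero, Matrix.cons_val_one]
  rw [hs.eq w v]

/-- For `q` twice continuously differentiable at `x`, `H(q)(x)` is a symmetric endomorphism
(`LinearMap.IsSymmetric`), i.e. a symmetric trace-free matrix in any orthonormal frame.
[folklore] -/
theorem isSymmetric_deviatoricHessian {q : E → ℝ} {x : E} (hq : ContDiffAt ℝ 2 q x) :
    (deviatoricHessian q x : E →ₗ[ℝ] E).IsSymmetric := fun v w => by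
  change ⟪deviatoricHessian q x v, w⟫ = ⟪v, deviatoricHessian q x w⟫
  rw [real_inner_comm, inner_deviatoricHessian_comm hq]

/-! ### Frobenius orthogonality of the splitting -/

/-- `|L + c I|² = |L|² + 2c · tr L + c² d` for an endomorphism `L` of a `d`-dimensional real inner
product space (Frobenius norm `frobeniusNormSq`, `FluidPDE/VectorCalculus`). [folklore] -/
theorem frobeniusNormSq_add_smul_id (L : E →L[ℝ] E) (c : ℝ) :
    frobeniusNormSq (L + c • ContinuousLinearMap.id ℝ E) =
      frobeniusNormSq L + 2 * c * LinearMap.trace ℝ E (L : E →ₗ[ℝ] E) +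
        c ^ 2 * (finrank ℝ E : ℝ) := by
  have hb : ∀ i, ‖stdOrthonormalBasis ℝ E i‖ = 1 := fun i =>
    (stdOrthonormalBasis ℝ E).orthonormal.1 i
  have hterm : ∀ i, ‖(L + c • ContinuousLinearMap.id ℝ E) (stdOrthonormalBasis ℝ E i)‖ ^ 2 =
      ‖L (stdOrthonormalBasis ℝ E i)‖ ^ 2 +
        2 * c * ⟪stdOrthonormalBasis ℝ E i, L (stdOrthonormalBasis ℝ E i)⟫ + c ^ 2 := by
    intro i
    have happ : (L + c • ContinuousLinearMap.id ℝ E) (stdOrthonormalBasis ℝ E i) =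
        L (stdOrthonormalBasis ℝ E i) + c • stdOrthonormalBasis ℝ E i := rfl
    rw [happ, norm_add_sq_real, real_inner_smul_right, real_inner_comm, norm_smul, hb i, mul_one,
      Real.norm_eq_abs, sq_abs]
    ring
  have htr : LinearMap.trace ℝ E (L : E →ₗ[ℝ] E) =
      ∑ i, ⟪stdOrthonormalBasis ℝ E i, L (stdOrthonormalBasis ℝ E i)⟫ :=
    LinearMap.trace_eq_sum_inner _ (stdOrthonormalBasis ℝ E)
  rw [frobeniusNormSq, frobeniusNormSq, htr, Finset.sum_congr rfl fun i _ => hterm i,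
    Finset.sum_add_distrib, Finset.sum_add_distrib, Finset.sum_const, Finset.card_univ,
    Fintype.card_fin, nsmul_eq_mul, Finset.mul_sum]
  ring

/-- **Frobenius orthogonality of the isotropic–deviatoric splitting:**
`|D(∇q)(x)|² = |H(q)(x)|² + (Δq(x))²/d`, for every `q` and `x`. For the Navier–Stokes pressure
in `ℝ³` (`Δp = 2Q`): `|∇²p|² = |H|² + (4/3)Q²`. [folklore] -/
theorem frobeniusNormSq_fderiv_gradient (q : E → ℝ) (x : E) :
    frobeniusNormSq (fderiv ℝ (gradient q) x) =
      frobeniusNormSq (deviatoricHessian q x) + (Δ q) x ^ 2 / (finrank ℝ E : ℝ) := by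
  rcases subsingleton_or_nontrivial E with hE | hE
  · simp [deviatoricHessian, finrank_zero_of_subsingleton]
  · have hd : (finrank ℝ E : ℝ) ≠ 0 := Nat.cast_ne_zero.2 finrank_pos.ne'
    conv_lhs => rw [fderiv_gradient_eq_deviatoricHessian_add q x]
    rw [frobeniusNormSq_add_smul_id, trace_deviatoricHessian, mul_zero, add_zero]
    congr 1
    field_simp

/-- The deviatoric part is dominated by the full Hessian: `|H(q)(x)|² ≤ |D(∇q)(x)|²`. [folklore] -/
theorem frobeniusNormSq_deviatoricHessian_le (q : E → ℝ) (x : E) :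
    frobeniusNormSq (deviatoricHessian q x) ≤ frobeniusNormSq (fderiv ℝ (gradient q) x) := by
  rw [frobeniusNormSq_fderiv_gradient]
  exact le_add_of_nonneg_right (div_nonneg (sq_nonneg _) (Nat.cast_nonneg _))

/-! ### Two calibrations: radial quadratics and translation-invariant fields -/

omit [FiniteDimensional ℝ E] in
/-- The gradient of the radial quadratic `y ↦ a‖y − x₀‖² + c` is `2a (y − x₀)`. [folklore] -/
theorem gradient_radial_quadratic [CompleteSpace E] (a c : ℝ) (x₀ : E) :
    gradient (fun y => a * ‖y - x₀‖ ^ 2 + c) = fun y => (2 * a) • (y - x₀) := by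
  funext y
  apply HasGradientAt.gradient
  rw [hasGradientAt_iff_hasFDerivAt]
  have h1 : HasFDerivAt (fun y : E => ‖y - x₀‖ ^ 2)
      (2 • (innerSL ℝ (y - x₀)).comp (ContinuousLinearMap.id ℝ E)) y :=
    ((hasFDerivAt_id y).sub_const x₀).norm_sq
  have h2 : HasFDerivAt (fun y : E => a * ‖y - x₀‖ ^ 2 + c)
      (a • (2 • (innerSL ℝ (y - x₀)).comp (ContinuousLinearMap.id ℝ E))) y :=
    (h1.const_mul a).add_const c
  refine h2.congr_fderiv (ContinuousLinearMap.ext fun w => ?_)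
  have e1 : (a • (2 • (innerSL ℝ (y - x₀)).comp (ContinuousLinearMap.id ℝ E))) w =
      a * (2 * ⟪y - x₀, w⟫) := by
    simp only [FunLike.coe_smul, Pi.smul_apply, ContinuousLinearMap.coe_comp, Function.comp_apply,
      ContinuousLinearMap.coe_id', id_eq, innerSL_apply_apply]
    rw [nsmul_eq_mul, smul_eq_mul, Nat.cast_ofNat]
  rw [e1, InnerProductSpace.toDual_apply_apply, real_inner_smul_left]
  ring

/-- **Radial quadratics have no deviatoric Hessian:** `H(y ↦ a‖y − x₀‖² + c) ≡ 0`
(`∇²q = 2a I`, `Δq = 2ad`; the round-blob calibration `∇²p(ξ, ξ) = Δp/3` in `ℝ³`). [folklore] -/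
theorem deviatoricHessian_radial_quadratic (a c : ℝ) (x₀ x : E) :
    deviatoricHessian (fun y => a * ‖y - x₀‖ ^ 2 + c) x = 0 := by
  haveI : CompleteSpace E := FiniteDimensional.complete ℝ E
  have hH : fderiv ℝ (gradient fun y => a * ‖y - x₀‖ ^ 2 + c) x =
      (2 * a) • ContinuousLinearMap.id ℝ E := by
    rw [gradient_radial_quadratic]
    exact (((hasFDerivAt_id x).sub_const x₀).const_smul (2 * a)).fderiv
  rcases subsingleton_or_nontrivial E with hE | hE
  · exact ContinuousLinearMap.ext fun v => Subsingleton.elim _ _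
  · have hd : (finrank ℝ E : ℝ) ≠ 0 := Nat.cast_ne_zero.2 finrank_pos.ne'
    rw [deviatoricHessian, ← trace_fderiv_gradient, hH, ContinuousLinearMap.toLinearMap_smul,
      map_smul, ContinuousLinearMap.coe_id, LinearMap.trace_id, smul_eq_mul, mul_div_assoc,
      div_self hd, mul_one, sub_self]

omit [FiniteDimensional ℝ E] in
/-- A field invariant under translations along `e` has a gradient invariant along `e`
(`Dq(y) = D(q ∘ (· + te))(y) = Dq(y + te)`, Mathlib's `fderiv_comp_add_right`, no
differentiability needed). [folklore] -/
theorem gradient_add_smul_of_forall_add_smul [CompleteSpace E] {q : E → ℝ} {e : E}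
    (hq : ∀ (y : E) (t : ℝ), q (y + t • e) = q y) (y : E) (t : ℝ) :
    gradient q (y + t • e) = gradient q y := by
  have h : fderiv ℝ q (y + t • e) = fderiv ℝ q y := by
    rw [← fderiv_comp_add_right (t • e)]
    exact congrArg (fun f => fderiv ℝ f y) (funext fun z => hq z t)
  simp only [gradient, h]

omit [FiniteDimensional ℝ E] in
/-- For `q` invariant under translations along `e`, the Hessian kills `e`: `D(∇q)(x) e = 0`
(the line derivative of the `e`-invariant field `∇q` along `e`; junk value `0` if `∇q` is not
differentiable at `x`). [folklore] -/
theorem fderiv_gradient_apply_eq_zero_of_forall_add_smul [CompleteSpace E] {q : E → ℝ} {e : E}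
    (hq : ∀ (y : E) (t : ℝ), q (y + t • e) = q y) (x : E) :
    fderiv ℝ (gradient q) x e = 0 := by
  by_cases hd : DifferentiableAt ℝ (gradient q) x
  · rw [← hd.lineDeriv_eq_fderiv, lineDeriv]
    simp_rw [gradient_add_smul_of_forall_add_smul hq]
    exact deriv_const (0 : ℝ) _
  · rw [fderiv_zero_of_not_differentiableAt hd]
    rfl

/-- **Translation-invariant fields:** if `q` is invariant under translations along `e`, then
`⟪e, H(q)(x) e⟫ = −(Δq(x)/d) ‖e‖²` — the deviatoric Hessian carries the full negative isotropic
share in the invariant direction. [folklore] -/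
theorem inner_deviatoricHessian_self_of_forall_add_smul {q : E → ℝ} {e : E}
    (hq : ∀ (y : E) (t : ℝ), q (y + t • e) = q y) (x : E) :
    ⟪e, deviatoricHessian q x e⟫ = -((Δ q) x / (finrank ℝ E : ℝ)) * ‖e‖ ^ 2 := by
  haveI : CompleteSpace E := FiniteDimensional.complete ℝ E
  rw [deviatoricHessian_apply, fderiv_gradient_apply_eq_zero_of_forall_add_smul hq, zero_sub,
    inner_neg_right, real_inner_smul_right, real_inner_self_eq_norm_sq, neg_mul]

/-- The `ℝ³` calibration of a straight column / `z`-invariant field: for `q : ℝ³ → ℝ` with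
`q(y + t e₃) = q(y)`, `⟪e₃, H(q)(x) e₃⟫ = −Δq(x)/3` (`e₃ = EuclideanSpace.single 2 1`).
[folklore] -/
theorem inner_deviatoricHessian_e₃_of_zInvariant {q : EuclideanSpace ℝ (Fin 3) → ℝ}
    (hq : ∀ (y : EuclideanSpace ℝ (Fin 3)) (t : ℝ), q (y + t • EuclideanSpace.single 2 1) = q y)
    (x : EuclideanSpace ℝ (Fin 3)) :
    ⟪EuclideanSpace.single 2 1, deviatoricHessian q x (EuclideanSpace.single 2 1)⟫ =
      -(Δ q) x / 3 := by
  rw [inner_deviatoricHessian_self_of_forall_add_smul hq, finrank_euclideanSpace_fin]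
  simp only [PiLp.norm_single, norm_one, one_pow, mul_one, Nat.cast_ofNat, neg_div]

end Literature.Analysis.FluidPDE
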